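import Literature.AlgebraicGeometry.Pohlmann1968.DivisorClassesCMAlgebra
import Literature.AlgebraicGeometry.HodgeTheory.AbelianVarietyPullbackAlgebraicClasses
import Literature.AlgebraicGeometry.Motives.AbelianVarietyCohomologyExteriorH1
import HarnessLib

/-!
# The distribution lemma: algebraic weight lines of a CM product lift along any slot map

COR-CM (cell `pub-hodgecm2`), seat b30 gen 15 (2026-08-21); count-neutral; theorems only, no definition, no named fact,
no `sorry`.  A general dictionary entry for Pohlmann's weights (the tree's `Pohlmann1968.weightClassesAlg`) on products
of CM abelian varieties, the tool behind «a Hodge class of a CM abelian variety is a sum of pull-backs of Weil classes»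
(André 1992; Milne 2020, Thm. 1) when the pull-back goes to a product WITH REPEATED FACTORS.

SETTING.  Realisations `(A_i, ι_i, θ_i)_{i<n}` of CM types `Φ_i` of number fields `K_i` read on `H¹`
(`IsCMTypeRealisation`), `Y = ⨁_i A_i`, and ANY slot map `κ : Fin N → Fin n`; the pulled-back family
`(A_{κ j}, ι_{κ j}, θ_{κ j})_{j<N}`, `X = ⨁_j A_{κ j}` (e.g. `X = A₀^a × A₁^b × ⋯`).  The index sets of the two CM algebras
are `⊔_j Hom(K_{κ j}, ℂ)` and `⊔_i Hom(K_i, ℂ)`, related by the slot projection `P = Sigma.map κ id : (j, s) ↦ (κ j, s)`.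
A weight `T` of `X` on which `P` is injective is a LIFT (a «distribution over the copies») of the weight `P(T)` of `Y`.

* `map_fibreSum_basis_one` — for the fibre-sum map `f = biproduct.desc (j ↦ ι_{κ j}) : X ⟶ Y` (on points:
  `(x_j)_j ↦ (Σ_{κ j = i} x_j)_i`) and Künneth eigenbases `w^X`, `w^Y` built from the same factor bases,
  `f^* w^Y_y = Σ_{P x = y} w^X_x` on `H¹`;
* **`weightClassesAlg_comp_le_algebraicClasses_of_injOn`** (THE DISTRIBUTION LEMMA) — if the weight line
  `H^{2p}(Y)_{P(T)}` consists of algebraic classes and `P` is injective on `T`, then the weight line `H^{2p}(X)_T`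
  consists of algebraic classes.  PROOF: `f^* w_{P(T)} = Σ_g w_{T_g}` over ALL lifts `T_g` of `P(T)` (multilinear
  expansion of the cup monomial, `complexBetti_map_cupPowOne`), `f^*` preserves algebraic classes
  (`map_mem_algebraicClasses_of_abelianVariety`), the monomials `w_{T_g}` of distinct lifts have distinct characters for
  the diagonal `∏_j 𝓞_{K_{κ j}}`-action (`exists_prod_apply_ne_of_ne`), which acts through algebraic correspondences
  preserving `Nᵖ`, so each `w_{T_g}` — in particular `w_T` — is algebraic (eigen-component extraction);
* `weightClassesAlg_comp_le_algebraicClasses_of_image_eq` — the same with the hypotheses `T.image P = S`,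
  `|T| = |S| = 2p`.

The one-slot case `n = 1` (powers of ONE abelian variety, `P = Sigma.snd`) is lit-pohlmann's
`CorankOne.weightClassesAlg_le_algebraicClasses_of_image_eq` (`Pohlmann1968/CorankOneCMTypePowersHodgeConjecture.lean`),
whose architecture is followed here; the injective case (a coordinate sub-product read inside the big product) is
complementary to p2's `CMWeights.weightClassesAlg_map_le_algebraicClasses` (pull-back ALONG a projection).
[cite: Milne2020HodgeClassesAV, 1.2 (a) and Thm. 1] [cite: Andre1992] [cite: Fulton1998, §19.2 Cor. 19.2 (b)]

## References
* [Milne2020HodgeClassesAV] J. S. Milne, *Hodge classes on abelian varieties*, arXiv:2010.08857, 1.2 (a), Thm. 1.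
* [Andre1992] Y. André, *Une remarque à propos des cycles de Hodge de type CM*, Sém. Théorie des Nombres Paris 1989–90,
  Progr. Math. 102 (1992) 1–7.
* [Fulton1998] W. Fulton, *Intersection Theory*, §19.2 Cor. 19.2 (b) (pull-backs of algebraic classes).
* [HatcherAT2002] A. Hatcher, *Algebraic Topology*, §3.2 (Künneth, naturality of cup products).
-/

noncomputable section

open CategoryTheory CategoryTheory.Limits NumberField

namespace Summit.HodgeConjecture.CorCM.CMWeights

open Literature.AlgebraicGeometry Literature.AlgebraicGeometry.Motives Literature.AlgebraicGeometry.HodgeTheory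
open Literature.AlgebraicGeometry.ComplexMultiplication (IsCMTypeRealisation)
open Literature.AlgebraicGeometry.Pohlmann1968
open Literature.AlgebraicTopology.SingularHomology
open Literature.NumberTheory.ComplexMultiplication
open Literature.NumberTheory.NumberFields (exists_ringOfIntegers_separating_embeddings)

open scoped Classical

/-! ## §1 Extracting an eigen-component from an invariant subspace -/

section Extraction

variable {F M : Type*} [Field F] [AddCommGroup M] [Module F M]

/-- **Eigen-component extraction.**  Let `P ⊆ M` be a subspace stable under a family of operators `T_j`, and let
`y_r` be simultaneous eigenvectors, `T_j y_r = μ_{j,r} y_r`, such that every `r ≠ r₀` is separated from `r₀` by some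
`T_j`.  If a combination `Σ_{r ∈ s} a_r y_r` with `a_{r₀} ≠ 0` lies in `P`, then `y_{r₀} ∈ P` (re-proof of the private
lemma of `Pohlmann1968/CorankOneCMTypePowersHodgeConjecture.lean`). [folklore] -/
private theorem mem_of_sum_smul_mem_of_separated {R J : Type*} (P : Submodule F M) (T : J → M →ₗ[F] M)
    (hT : ∀ j, ∀ v ∈ P, T j v ∈ P) (y : R → M) (μ : J → R → F) (hy : ∀ j r, T j (y r) = μ j r • y r)
    (r₀ : R) (hsep : ∀ r, r ≠ r₀ → ∃ j, μ j r ≠ μ j r₀) :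
    ∀ (s : Finset R) (a : R → F), r₀ ∈ s → a r₀ ≠ 0 → (∑ r ∈ s, a r • y r) ∈ P → y r₀ ∈ P := by
  intro s
  induction s using Finset.strongInduction with
  | H s ih =>
    intro a hr₀ ha₀ hsum
    by_cases hs : ∃ r ∈ s, r ≠ r₀
    · obtain ⟨r₁, hr₁, hr₁₀⟩ := hs
      obtain ⟨j, hj⟩ := hsep r₁ hr₁₀
      have h1 : T j (∑ r ∈ s, a r • y r) - μ j r₁ • (∑ r ∈ s, a r • y r) ∈ P :=
        P.sub_mem (hT j _ hsum) (P.smul_mem _ hsum)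
      have h3 : ∀ r, T j (a r • y r) - μ j r₁ • (a r • y r) = (a r * (μ j r - μ j r₁)) • y r := by
        intro r
        rw [map_smul, hy, smul_smul, smul_smul, ← sub_smul]
        congr 1
        ring
      have h2 : T j (∑ r ∈ s, a r • y r) - μ j r₁ • (∑ r ∈ s, a r • y r) =
          ∑ r ∈ s.erase r₁, (a r * (μ j r - μ j r₁)) • y r := by
        rw [map_sum, Finset.smul_sum, ← Finset.sum_sub_distrib, Finset.sum_congr rfl (fun r _ => h3 r),
          ← Finset.sum_erase_add _ _ hr₁, sub_self, mul_zero, zero_smul, add_zero]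
      refine ih (s.erase r₁) (Finset.erase_ssubset hr₁) (fun r => a r * (μ j r - μ j r₁))
        (Finset.mem_erase.2 ⟨fun h => hr₁₀ h.symm, hr₀⟩) (mul_ne_zero ha₀ (sub_ne_zero.2 (Ne.symm hj))) ?_
      rw [← h2]
      exact h1
    · push Not at hs
      have hs' : s = {r₀} := Finset.eq_singleton_iff_unique_mem.2 ⟨hr₀, hs⟩
      rw [hs', Finset.sum_singleton] at hsum
      have h := P.smul_mem (a r₀)⁻¹ hsum
      rwa [smul_smul, inv_mul_cancel₀ ha₀, one_smul] at h

end Extraction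

/-! ## §2 The fibre-sum map and the two Künneth eigenbases -/

section FibreSum

variable {N n : ℕ} {K : Fin n → Type} [∀ i, Field (K i)]
  {A : Fin n → AbelianVariety ℂ} (κ : Fin N → Fin n)

/-- **The fibre-sum map pulls a Künneth basis vector of `Y = ⨁_i A_i` back to the sum of the basis vectors of
`X = ⨁_j A_{κ j}` over its fibre.**  For factor bases `v_i` of `H¹(A_i)`, the Künneth bases `w^Y_{(i,s)} = π_i^* v_{i,s}`
and `w^X_{(j,s)} = π_j^* v_{κ j, s}`, and `f = biproduct.desc (j ↦ ι_{κ j}) : X ⟶ Y`: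
`f^* w^Y_y = Σ_{x : P x = y} w^X_x`, `P (j, s) = (κ j, s)` (test against every `ι_j^*`: `ι_j ≫ f = ι_{κ j}` and
`ι^* π^* = δ`). [cite: HatcherAT2002, §3.2 Thm. 3.16] -/
theorem map_fibreSum_basis_one {I : Fin n → Type} [∀ i, Fintype (I i)]
    (v : ∀ i, Module.Basis (I i) ℂ (complexBetti (A i).X 1))
    {wY : Module.Basis ((i : Fin n) × I i) ℂ (complexBetti (⨁ A).X 1)}
    (hwY : ∀ y, wY y = complexBetti.map (biproduct.π A y.1).hom.hom.hom 1 (v y.1 y.2))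
    {wX : Module.Basis ((j : Fin N) × I (κ j)) ℂ (complexBetti (⨁ fun j => A (κ j)).X 1)}
    (hwX : ∀ x, wX x = complexBetti.map (biproduct.π (fun j => A (κ j)) x.1).hom.hom.hom 1 (v (κ x.1) x.2))
    (y : (i : Fin n) × I i) :
    complexBetti.map (biproduct.desc fun j => biproduct.ι A (κ j) :
        (⨁ fun j => A (κ j)) ⟶ ⨁ A).hom.hom.hom 1 (wY y) =
      ∑ x ∈ Finset.univ.filter (fun x : (j : Fin N) × I (κ j) => Sigma.map κ (fun _ => id) x = y), wX x := by
  -- test against `ι_j^*` for every slot `j` of `X`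
  rw [← sum_map_π_map_ι (fun j => A (κ j)) (complexBetti.map (biproduct.desc fun j => biproduct.ι A (κ j) :
      (⨁ fun j => A (κ j)) ⟶ ⨁ A).hom.hom.hom 1 (wY y)),
    ← sum_map_π_map_ι (fun j => A (κ j)) (∑ x ∈ Finset.univ.filter _, wX x)]
  refine Finset.sum_congr rfl fun j _ => ?_
  congr 1
  -- left: `ι_j^* f^* π_i^* v = (ι_{κ j} ≫ π_i)^* v`
  have hL : ∀ (i : Fin n) (z : complexBetti (A i).X 1),
      complexBetti.map (biproduct.ι (fun j => A (κ j)) j).hom.hom.hom 1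
        (complexBetti.map (biproduct.desc fun j => biproduct.ι A (κ j) :
          (⨁ fun j => A (κ j)) ⟶ ⨁ A).hom.hom.hom 1 (complexBetti.map (biproduct.π A i).hom.hom.hom 1 z)) =
      complexBetti.map (biproduct.ι A (κ j) ≫ biproduct.π A i).hom.hom.hom 1 z := by
    intro i z
    rw [abelianVarietyHom_map_map_apply, abelianVarietyHom_map_map_apply, biproduct.ι_desc]
  rw [hwY, hL, map_sum]
  -- right: only the basis vectors of slot `j` survive `ι_j^*`
  obtain ⟨i, s⟩ := y
  by_cases hij : κ j = i
  · subst hij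
    have hmem : (⟨j, s⟩ : (j : Fin N) × I (κ j)) ∈
        Finset.univ.filter (fun x : (j : Fin N) × I (κ j) => Sigma.map κ (fun _ => id) x = ⟨κ j, s⟩) :=
      Finset.mem_filter.2 ⟨Finset.mem_univ _, rfl⟩
    rw [Finset.sum_eq_single_of_mem _ hmem (fun x hx hxj => ?_)]
    · rw [hwX, map_ι_map_π_self]
      change complexBetti.map (biproduct.ι A (κ j) ≫ biproduct.π A (κ j)).hom.hom.hom 1 (v (κ j) s) = v (κ j) s
      rw [biproduct.ι_π_self]
      exact abelianVariety_map_id_apply _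
    · -- `x = (j', s')` with `(κ j', s') = (κ j, s)` and `x ≠ (j, s)`: then `j' ≠ j`
      have hx' : Sigma.map κ (fun _ => id) x = ⟨κ j, s⟩ := (Finset.mem_filter.1 hx).2
      have hj' : x.1 ≠ j := by
        intro h
        apply hxj
        obtain ⟨j', s'⟩ := x
        change j' = j at h
        subst h
        have h2 : s' = s := eq_of_heq (Sigma.mk.inj_iff.1 hx').2
        rw [h2]
      rw [hwX, map_ι_map_π_ne (fun j => A (κ j)) (Ne.symm hj')]
  · change complexBetti.map (biproduct.ι A (κ j) ≫ biproduct.π A i).hom.hom.hom 1 (v i s) = _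
    rw [biproduct.ι_π_ne A hij]
    change complexBetti.map (0 : A (κ j) ⟶ A i).hom.hom.hom 1 (v i s) = _
    rw [complexBetti_map_zero_one, Finset.sum_eq_zero fun x hx => ?_]
    · rfl
    · have hx' : Sigma.map κ (fun _ => id) x = ⟨i, s⟩ := (Finset.mem_filter.1 hx).2
      have hj' : x.1 ≠ j := by
        intro h
        apply hij
        rw [← h]
        exact (Sigma.mk.inj_iff.1 hx').1
      rw [hwX, map_ι_map_π_ne (fun j => A (κ j)) (Ne.symm hj')]

end FibreSum

/-! ## §3 The distribution lemma -/

section Distribution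

variable {N n : ℕ} {K : Fin n → Type} [∀ i, Field (K i)] [∀ i, NumberField (K i)]
  {A : Fin n → AbelianVariety ℂ} {Φ : ∀ i, CMType (K i)} {ι : ∀ i, 𝓞 (K i) →+* End (A i)}
  {θ : ∀ i, K i →+* Module.End ℂ (complexBetti (A i).X 1)}

/-- **THE DISTRIBUTION LEMMA.**  Let `(A_i, ι_i, θ_i)_{i<n}` realise CM types of number fields `K_i`, let
`κ : Fin N → Fin n` be any slot map, `X = ⨁_j A_{κ j}`, `Y = ⨁_i A_i`, `P (j, s) = (κ j, s)` the slot projection of the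
index sets.  If `T ⊆ ⊔_j Hom(K_{κ j}, ℂ)`, `|T| = 2p`, is mapped injectively by `P` and the weight line
`H^{2p}(Y)_{P(T)}` lies in `Nᵖ H^{2p}(Y)`, then the weight line `H^{2p}(X)_T` lies in `Nᵖ H^{2p}(X)`.  With the fibre-sum
map `f : X ⟶ Y`, `f^* w_{P(T)} = Σ_g w_{T_g}` over all lifts `T_g` of `P(T)`; `f^*` preserves algebraic classes; the
lifts are separated by the diagonal `∏_j 𝓞_{K_{κ j}}`-action through algebraic correspondences preserving `Nᵖ`, so
`w_T` is algebraic. [cite: Milne2020HodgeClassesAV, 1.2 (a) and Thm. 1] [cite: Andre1992]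
[cite: Fulton1998, §19.2 Cor. 19.2 (b)] -/
theorem weightClassesAlg_comp_le_algebraicClasses_of_injOn
    (hA : ∀ i, IsCMTypeRealisation (Φ i) (A i) (ι i) (θ i)) (κ : Fin N → Fin n) {p : ℕ}
    {T : Finset ((j : Fin N) × (K (κ j) →+* ℂ))} (hTcard : T.card = 2 * p)
    (hTinj : Set.InjOn (Sigma.map κ (fun _ => id) : ((j : Fin N) × (K (κ j) →+* ℂ)) → ((i : Fin n) × (K i →+* ℂ)))
      (T : Set ((j : Fin N) × (K (κ j) →+* ℂ))))
    (halg : weightClassesAlg A ι (2 * p)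
      (T.image (Sigma.map κ (fun _ => id) : ((j : Fin N) × (K (κ j) →+* ℂ)) → ((i : Fin n) × (K i →+* ℂ)))) ≤
        algebraicClasses (⨁ A).X p) :
    weightClassesAlg (fun j => A (κ j)) (fun j => ι (κ j)) (2 * p) T ≤
      algebraicClasses (⨁ fun j => A (κ j)).X p := by
  set P : ((j : Fin N) × (K (κ j) →+* ℂ)) → ((i : Fin n) × (K i →+* ℂ)) := Sigma.map κ fun _ => id with hP_def
  set S : Finset ((i : Fin n) × (K i →+* ℂ)) := T.image P with hS_def
  have hScard : S.card = 2 * p := by rw [hS_def, Finset.card_image_of_injOn hTinj, hTcard]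
  -- linear orders: any order on the index set of `Y`; on that of `X` compare `P`-images FIRST, then the slot
  letI : LinearOrder ((i : Fin n) × (K i →+* ℂ)) :=
    LinearOrder.lift' (Fintype.equivFin _) (Fintype.equivFin _).injective
  letI : LinearOrder ((j : Fin N) × (K (κ j) →+* ℂ)) :=
    LinearOrder.lift' (fun x : (j : Fin N) × (K (κ j) →+* ℂ) => toLex (P x, x.1)) (by
      rintro ⟨j, s⟩ ⟨j', s'⟩ h
      have h' := toLex.injective h
      simp only [Prod.mk.injEq] at h'
      obtain ⟨h1, h2⟩ := h'
      subst h2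
      have h3 : s = s' := eq_of_heq (Sigma.mk.inj_iff.1 h1).2
      rw [h3])
  -- `S` as a `2p`-subset and its increasing enumeration `σ`
  let uS : Set.powersetCard ((i : Fin n) × (K i →+* ℂ)) (2 * p) := Set.powersetCard.ofCard hScard
  let σe : Fin (2 * p) ↪o ((i : Fin n) × (K i →+* ℂ)) := Set.powersetCard.ofFinEmbEquiv.symm uS
  let σ : Fin (2 * p) → ((i : Fin n) × (K i →+* ℂ)) := fun t => σe t
  have hσmem : ∀ t, σ t ∈ S := fun t => by
    have h : σ t ∈ Set.range (Set.powersetCard.ofFinEmbEquiv.symm uS) := ⟨t, rfl⟩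
    exact (Set.powersetCard.mem_range_ofFinEmbEquiv_symm_iff_mem uS _).1 h
  have hσinj : Function.Injective σ := σe.injective
  -- eigenbases of the factors, Künneth eigenbases of `X` and `Y`, monomial bases
  have hX : IsSmoothProjective (⨁ fun j => A (κ j)).dim (⨁ fun j => A (κ j)).X :=
    Motives.AbelianVariety.isSmoothProjective_holds
  have hY : IsSmoothProjective (⨁ A).dim (⨁ A).X := Motives.AbelianVariety.isSmoothProjective_holds
  have hvex : ∀ i, ∃ v : Module.Basis (K i →+* ℂ) ℂ (complexBetti (A i).X 1),
      ∀ s (c : K i), θ i c (v s) = s c • v s := fun i => by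
    obtain ⟨β, hβ⟩ := exists_ringOfIntegers_separating_embeddings (F := K i)
    exact exists_eigenbasis (hA i) hβ
  choose v hv using hvex
  have hθ : ∀ (i : Fin n) (c : 𝓞 (K i)) (s : K i →+* ℂ),
      complexBetti.map (ι i c).hom.hom.hom 1 (v i s) = s (c : K i) • v i s := fun i c s => by
    rw [show complexBetti.map (ι i c).hom.hom.hom 1 (v i s) =
      (complexBetti.map (ι i c).hom.hom.hom 1).hom (v i s) from rfl, (hA i).2.2.1 c]
    exact hv i s c
  obtain ⟨wY, hwY⟩ := exists_biproductBasis_sigma A v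
  obtain ⟨wX, hwX⟩ := exists_biproductBasis_sigma (fun j => A (κ j)) fun j => v (κ j)
  have hwYι : ∀ (c : ∀ i, 𝓞 (K i)) (y : (i : Fin n) × (K i →+* ℂ)),
      complexBetti.map (biproduct.map fun i => ι i (c i)).hom.hom.hom 1 (wY y) =
        y.2 ((c y.1 : 𝓞 (K y.1)) : K y.1) • wY y := fun c y => by
    rw [hwY y, map_biproductMap_map_π, hθ, map_smul]
  have hwXι : ∀ (c : ∀ j, 𝓞 (K (κ j))) (x : (j : Fin N) × (K (κ j) →+* ℂ)),
      complexBetti.map (biproduct.map fun j => ι (κ j) (c j)).hom.hom.hom 1 (wX x) =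
        x.2 ((c x.1 : 𝓞 (K (κ x.1))) : K (κ x.1)) • wX x := fun c x => by
    rw [hwX x, map_biproductMap_map_π, hθ, map_smul]
  obtain ⟨bY, hbY⟩ := exists_monomialBasis wY (2 * p)
  obtain ⟨bX, hbX⟩ := exists_monomialBasis wX (2 * p)
  have hbY' : ∀ s, bY s = cupMonomial wY (2 * p) s := hbY
  have hbX' : ∀ s, bX s = cupMonomial wX (2 * p) s := hbX
  -- the fibres of `P` over the points `σ t` and the lifts `g ∈ Π_t P⁻¹(σ t)`, increasingly enumerated
  let Fb : Fin (2 * p) → Finset ((j : Fin N) × (K (κ j) →+* ℂ)) := fun t =>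
    Finset.univ.filter fun x => P x = σ t
  have hmemFb : ∀ t x, x ∈ Fb t ↔ P x = σ t := fun t x => by
    simp only [Fb, Finset.mem_filter, Finset.mem_univ, true_and]
  have hmono : ∀ g : Fin (2 * p) → ((j : Fin N) × (K (κ j) →+* ℂ)), (∀ t, P (g t) = σ t) → StrictMono g := by
    intro g hg t t' htt'
    change toLex (P (g t), (g t).1) < toLex (P (g t'), (g t').1)
    rw [hg, hg]
    exact Prod.Lex.toLex_lt_toLex.2 (Or.inl (σe.strictMono htt'))
  let u : (g : Fin (2 * p) → ((j : Fin N) × (K (κ j) →+* ℂ))) → (∀ t, P (g t) = σ t) →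
      Set.powersetCard ((j : Fin N) × (K (κ j) →+* ℂ)) (2 * p) := fun g hg =>
    Set.powersetCard.ofFinEmbEquiv (OrderEmbedding.ofStrictMono g (hmono g hg))
  have hmem_u : ∀ g hg (x : (j : Fin N) × (K (κ j) →+* ℂ)),
      x ∈ ((u g hg : Set.powersetCard _ (2 * p)) : Finset ((j : Fin N) × (K (κ j) →+* ℂ))) ↔ ∃ t, g t = x := by
    intro g hg x
    rw [Set.powersetCard.mem_coe_iff]
    change x ∈ Set.powersetCard.ofFinEmbEquiv (OrderEmbedding.ofStrictMono g (hmono g hg)) ↔ _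
    rw [Set.powersetCard.mem_ofFinEmbEquiv_iff_mem_range, Set.mem_range]
    rfl
  have hbu : ∀ g hg, bX (u g hg) = cupPowOne ℂ (ComplexPoints (⨁ fun j => A (κ j)).X) (2 * p) fun t => wX (g t) := by
    intro g hg
    rw [hbX]
    congr 1
    funext t
    show wX ((Set.powersetCard.ofFinEmbEquiv.symm (Set.powersetCard.ofFinEmbEquiv
      (OrderEmbedding.ofStrictMono g (hmono g hg)))) t) = wX (g t)
    rw [Equiv.symm_apply_apply]
    rfl
  -- distinct lifts give distinct index sets
  have hu_inj : ∀ g hg g' hg', ((u g hg : Set.powersetCard _ (2 * p)) : Finset ((j : Fin N) × (K (κ j) →+* ℂ))) =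
      (u g' hg' : Finset _) → g = g' := by
    intro g hg g' hg' h
    funext t
    have ht : g t ∈ ((u g' hg' : Set.powersetCard _ (2 * p)) : Finset _) := by
      rw [← h]
      exact (hmem_u g hg _).2 ⟨t, rfl⟩
    obtain ⟨t', ht'⟩ := (hmem_u g' hg' _).1 ht
    have htt : t' = t := hσinj (by rw [← hg' t', ht', hg t])
    subst htt
    exact ht'.symm
  -- `T` is the lift `g₀`: for each `t` the unique point of `T` over `σ t`
  have hex : ∀ t : Fin (2 * p), ∃ x ∈ T, P x = σ t := fun t => by
    have ht : σ t ∈ T.image P := hσmem t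
    obtain ⟨x, hxT, hx⟩ := Finset.mem_image.1 ht
    exact ⟨x, hxT, hx⟩
  choose g₀ hg₀T hg₀ using hex
  have hsub : ((u g₀ hg₀ : Set.powersetCard _ (2 * p)) : Finset ((j : Fin N) × (K (κ j) →+* ℂ))) ⊆ T := by
    intro x hx
    obtain ⟨t, rfl⟩ := (hmem_u g₀ hg₀ x).1 hx
    exact hg₀T t
  have huT : ((u g₀ hg₀ : Set.powersetCard _ (2 * p)) : Finset ((j : Fin N) × (K (κ j) →+* ℂ))) = T :=
    Finset.eq_of_subset_of_card_le hsub (le_of_eq (by rw [hTcard, Set.powersetCard.card_eq]))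
  -- the monomial `w_S` of `Y` lies on the weight line of `S`, hence is algebraic
  have huS : ((uS : Set.powersetCard _ (2 * p)) : Finset ((i : Fin n) × (K i →+* ℂ))) = S := rfl
  set x₀ : complexBetti (⨁ A).X (2 * p) := cupPowOne ℂ (ComplexPoints (⨁ A).X) (2 * p) (fun t => wY (σ t))
    with hx₀_def
  have hbYuS : bY uS = x₀ := hbY uS
  have hx₀alg : x₀ ∈ algebraicClasses (⨁ A).X p := by
    apply halg
    rw [← huS, weightClassesAlg_eq_span_singleton hwYι hbY' uS, hbYuS]
    exact Submodule.mem_span_singleton_self _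
  -- its pull-back along the fibre-sum map is algebraic …
  let f : (⨁ fun j => A (κ j)) ⟶ ⨁ A := biproduct.desc fun j => biproduct.ι A (κ j)
  have hxalg : complexBetti.map f.hom.hom.hom (2 * p) x₀ ∈ algebraicClasses (⨁ fun j => A (κ j)).X p :=
    map_mem_algebraicClasses_of_abelianVariety hX (⨁ A) f.hom.hom.hom hx₀alg
  -- … and expands as the sum of the monomials of ALL lifts
  have hexp : complexBetti.map f.hom.hom.hom (2 * p) x₀ =
      ∑ g ∈ Fintype.piFinset Fb, cupPowOne ℂ (ComplexPoints (⨁ fun j => A (κ j)).X) (2 * p) fun t => wX (g t) := by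
    rw [hx₀_def, complexBetti_map_cupPowOne]
    have h1 : (fun t => complexBetti.map f.hom.hom.hom 1 (wY (σ t))) = fun t => ∑ x ∈ Fb t, wX x := by
      funext t
      exact map_fibreSum_basis_one κ v hwY hwX (σ t)
    rw [h1]
    exact MultilinearMap.map_sum_finset (cupPowOne ℂ (ComplexPoints (⨁ fun j => A (κ j)).X) (2 * p))
      (fun _ x => wX x) Fb
  -- rewrite the sum over `piFinset Fb` as a sum of basis monomials `bX (u g _)` indexed by the subtype of lifts
  have hmemPi : ∀ g, g ∈ Fintype.piFinset Fb ↔ ∀ t, P (g t) = σ t := fun g => by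
    rw [Fintype.mem_piFinset]
    exact forall_congr' fun t => hmemFb t (g t)
  let L : Type := {g : Fin (2 * p) → ((j : Fin N) × (K (κ j) →+* ℂ)) // ∀ t, P (g t) = σ t}
  haveI : Fintype L := by unfold L; infer_instance
  let U : L → Set.powersetCard ((j : Fin N) × (K (κ j) →+* ℂ)) (2 * p) := fun g => u g.1 g.2
  have hexp' : complexBetti.map f.hom.hom.hom (2 * p) x₀ = ∑ g : L, (1 : ℂ) • bX (U g) := by
    rw [hexp]
    have h2 : ∑ g : L, (1 : ℂ) • bX (U g) =
        ∑ g : L, cupPowOne ℂ (ComplexPoints (⨁ fun j => A (κ j)).X) (2 * p) fun t => wX (g.1 t) :=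
      Finset.sum_congr rfl fun g _ => by rw [one_smul]; exact hbu g.1 g.2
    rw [h2]
    exact Finset.sum_subtype (Fintype.piFinset Fb) (fun g => hmemPi g) fun g =>
      cupPowOne ℂ (ComplexPoints (⨁ fun j => A (κ j)).X) (2 * p) fun t => wX (g t)
  rw [hexp'] at hxalg
  -- extraction of the `T`-component by the diagonal `∏_j 𝓞_{K_{κ j}}`-action
  let g₀' : L := ⟨g₀, hg₀⟩
  have hmem : bX (U g₀') ∈ algebraicClasses (⨁ fun j => A (κ j)).X p := by
    refine mem_of_sum_smul_mem_of_separated (F := ℂ) (algebraicClasses (⨁ fun j => A (κ j)).X p)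
      (fun c : ∀ j, 𝓞 (K (κ j)) => (complexBetti.map (biproduct.map fun j => ι (κ j) (c j)).hom.hom.hom (2 * p)).hom)
      (fun c y hy => map_mem_algebraicClasses_of_abelianVariety hX (⨁ fun j => A (κ j))
        (biproduct.map fun j => ι (κ j) (c j)).hom.hom.hom hy)
      (fun g => bX (U g))
      (fun c g => ∏ y ∈ ((U g : Set.powersetCard _ (2 * p)) : Finset ((j : Fin N) × (K (κ j) →+* ℂ))),
        y.2 ((c y.1 : 𝓞 (K (κ y.1))) : K (κ y.1)))
      (fun c g => map_monomial_eq_prod_smul hbX _ (hwXι c) (U g)) g₀' (fun g hg => ?_)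
      Finset.univ (fun _ => 1) (Finset.mem_univ _) one_ne_zero hxalg
    have hne : ((U g : Set.powersetCard _ (2 * p)) : Finset ((j : Fin N) × (K (κ j) →+* ℂ))) ≠ (U g₀' : Finset _) := by
      intro h
      apply hg
      exact Subtype.ext (hu_inj g.1 g.2 g₀ hg₀ h)
    exact exists_prod_apply_ne_of_ne (K := fun j : Fin N => K (κ j)) hne
  -- the weight line of `T` is the line of `w_T = bX (U g₀')`
  rw [← huT, weightClassesAlg_eq_span_singleton hwXι hbX' (u g₀ hg₀), Submodule.span_singleton_le_iff_mem]
  exact hmem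

/-- **The distribution lemma, `image` form**: if `T.image P = S` with `|T| = |S| = 2p` and the weight line of `S` on
`Y = ⨁_i A_i` is algebraic, the weight line of `T` on `X = ⨁_j A_{κ j}` is algebraic.
[cite: Milne2020HodgeClassesAV, 1.2 (a) and Thm. 1] [cite: Andre1992] -/
theorem weightClassesAlg_comp_le_algebraicClasses_of_image_eq
    (hA : ∀ i, IsCMTypeRealisation (Φ i) (A i) (ι i) (θ i)) (κ : Fin N → Fin n) {p : ℕ}
    {S : Finset ((i : Fin n) × (K i →+* ℂ))} (hScard : S.card = 2 * p)
    (halg : weightClassesAlg A ι (2 * p) S ≤ algebraicClasses (⨁ A).X p)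
    {T : Finset ((j : Fin N) × (K (κ j) →+* ℂ))}
    (hTim : T.image (Sigma.map κ (fun _ => id) : ((j : Fin N) × (K (κ j) →+* ℂ)) → ((i : Fin n) × (K i →+* ℂ))) = S)
    (hTcard : T.card = 2 * p) :
    weightClassesAlg (fun j => A (κ j)) (fun j => ι (κ j)) (2 * p) T ≤
      algebraicClasses (⨁ fun j => A (κ j)).X p := by
  refine weightClassesAlg_comp_le_algebraicClasses_of_injOn hA κ hTcard ?_ (by rw [hTim]; exact halg)
  exact Finset.injOn_of_card_image_eq (by rw [hTim, hScard, hTcard])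

end Distribution

end Summit.HodgeConjecture.CorCM.CMWeights

end
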